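import Summits.BirchSwinnertonDyer.BirchSwinnertonDyer.Theorems.ErratumRoadFiveNonSurjCornerKolyJLevelOneSupply
import Summits.BirchSwinnertonDyer.BirchSwinnertonDyer.Theorems.ErratumRoadFiveNonSurjCornerKolyJLevelOneAvatar
import Summits.BirchSwinnertonDyer.BirchSwinnertonDyer.Theorems.ErratumRoadFiveNonSurjCornerKolyJLevelTransport
import Summits.BirchSwinnertonDyer.BirchSwinnertonDyer.Theorems.ErratumRoadFiveNonSurjCornerKolyJProp44StandingInputs
import Summits.BirchSwinnertonDyer.BirchSwinnertonDyer.Theorems.ClassRecordThreeEulerHalvesAtThreeWalkSupplyRootTransverse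
import Literature.NumberTheory.EllipticCurves.GrossLMS1991.HeegnerEulerSystemCongruenceImageFree
import Summits.BirchSwinnertonDyer.BirchSwinnertonDyer.Theorems.ErratumRoadFiveNonSurjCornerKolyJProp44AnyPair
import HarnessLib

/-!
# Route `ErratumRoadFive` (rung K2), crux child `NonSurjCornerKolyJ` (item stmt-BirchSwinnertonDyer-19947), registered stub
# `stub_kolyJ_max`: the κ̄-DICTIONARY of the swap supply is KERNEL modulo Gross Prop. 3.7 (2) BY NAME
# (cell `bsd-stepL`, seat `bsd-stepL-corner-p1` g11; `--supports stmt-BirchSwinnertonDyer-19947`; memo CORNER-G10 §3 (2)–(3))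

WHY. The reading of record of `stub_kolyJ_max` (`Koly.nonSurjCornerKolyJ_max_of_levelOneSupply_of_perLevel`, p522786; and
its (T4″)@3 twin for 19111's Upper kit) asks, per corner frame and per family `D` of Kolyvagin–Heegner data over the
Zhang–Kolyvagin conductors of index `≥ M+1` with all derived points `p^M`-divisible, for a level-`p` package (iv): `τ`, a
Selmer structure `𝒯`, signs `eb`, the duality count `hPT`, the local Tate pairing (`pair`/`hperf`/`hrec`) AND a
"κ̄-dictionary": classes `κ̄_s ∈ H¹(K, E[p])` with signed Selmer membership `hκSel`, McCallum's Prop. 4.4 in non-vanishing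
form `h44c` (`loc_λ κ̄_{sℓ} = 0 ↔ loc_λ κ̄_s = 0`) and `hκ0` (`κ̄_s ≠ 0 ↔ p^{M+1} ∤ P_s`). Sessions g8–g10 made every piece
of that dictionary kernel SEPARATELY: the avatar `κ̄_s := c_p(P_s ∕ p^M)` with `ι_* κ̄_s = c_{M+1}(s)` and `hκ0`
(`exists_levelOne_avatar`, p516360), the transport of `h44c` along `ι_*` (`localization_eq_zero_iff_transport`, p517266),
and Prop. 4.4 «in particular» for ANY two data on the irreducible cell modulo (γ) (`Prop44.…_of_irr`, p544902), with
(γ) = Gross Prop. 3.7 (2) now the Literature fact `GrossLMS1991.prop37_2_frobeniusCongruence` (lit g24 ∕ g26, pair reading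
`reductionCongruence_pair` p543496). THIS FILE ASSEMBLES THEM:
* `exists_levelOne_kappa_of_h44` (fact-free, `p`-generic): from the standing inputs on the irreducible cell (x11b3
  `NoTorsionIrr` admissibility with the PROVED Weil pairing; `[P_s]` invariant, `Prop44.toGeomPoints_derivedPoint_mem_invPoints`)
  and a level-`p^{M+1}` Prop-4.4 supplier `h44` for the GENUINE classes `c_{M+1}(D s)`, the family `κ̄` with
  `ι_* κ̄_s = c_{M+1}(D s)`, `h44c` and `hκ0` (`Γ_{K_λ}` fixes `E[p^{M+1}]`: tam3 ∕ bsd-jet `Walk.resGal_adicCompletion_smul_torsion_eq_self`).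
* `h44_family_of_frobeniusCongruence` (`p ∉ {2,3}`): the supplier `h44` BY NAME of the Literature fact (Nekovář's clause
  `ℓ ≠ 2` is automatic: `p^{M+1} ∣ ℓ + 1`, `p ≠ 3`).
* `h44_family_three_of_frobeniusCongruence` (`p = 3`): the same modulo the explicit `ℓ = 2` residue `h2` (a
  Zhang–Kolyvagin prime `2` is possible at `p = 3`, `M = 0`; outside Nekovář's `ℓ𝒪_K ∤ (2)` and Gross's §2).
The displays built on these (`…SwapKappaDisplay.lean`) drop `κb ∕ hκSel ∕ h44c ∕ hκ0` from (iv) in favour of ONE clause on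
the genuine classes. HONEST FRAMING: three theorems, no definition ∕ fact ∕ sorry; CONDITIONAL on the named fact where
stated; no stub closes; nothing about any curve; BSD is not advanced; T7.
References: [McCallumLMS1991] §4 Lemma 4.1, Lemma 4.3, Prop. 4.4, Cor. 4.5, §5 Prop. 5.2; [GrossLMS1991] Prop. 3.6,
Prop. 3.7 (2), §4 (4.1); [Nekovar2007] Prop. 4.13 (ii), (4.3); [BurungaleEtAl2026] Prop. 2.2.1; [Jetchev2008] Prop. 4.4,
Thm. 1.4; [WZhang2014] Notations (xii).
-/

set_option autoImplicit false

noncomputable section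

open scoped Classical NumberField

namespace Summit.BirchSwinnertonDyer.Rank1Residual.X11b.Three.Koly

open WeierstrassCurve IsDedekindDomain NumberField Field Literature.NumberTheory.EllipticCurves
  Literature.NumberTheory.EllipticCurves.ModularForms Literature.NumberTheory.EllipticCurves.Jetchev2008
  Literature.NumberTheory.EllipticCurves.Rank1Residual Literature.NumberTheory.EllipticCurves.KolyvaginCocycle
  Literature.NumberTheory.GaloisRepresentations Literature.NumberTheory.GaloisCohomology
  Literature.NumberTheory.GaloisRepresentations.DiscreteGaloisModule
  Summit.BirchSwinnertonDyer.Rank1Residual Summit.BirchSwinnertonDyer.Rank1Residual.X11b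
  Summit.BirchSwinnertonDyer.Rank1Residual.JET
  Summit.BirchSwinnertonDyer.BirchSwinnertonDyer.Theorems

variable {K : Type} [Field K] [NumberField K] (W : WeierstrassCurve ℚ) [W.IsElliptic] [W.IsGloballyMinimal]
  [NeZero (W.conductorNorm ℤ)]

/-- **The κ̄-dictionary of the swap supply is KERNEL modulo a level-`p^{M+1}` Prop-4.4 supplier** (`E[p]` irreducible,
`p` odd split in `K`). For a family `D` of Kolyvagin–Heegner data over the Zhang–Kolyvagin conductors of index `≥ M+1`
with every derived point `p^M`-divisible (`hall`), and the non-vanishing form of McCallum Prop. 4.4 at level `p^{M+1}`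
for the GENUINE classes `c_{M+1}(D s)` along prime steps (`h44`), there are level-`p` classes `κ̄_s ∈ H¹(K, E[p])` with
`ι_* κ̄_s = c_{M+1}(D s)`, the swap supply's `h44c` clause (`loc_λ κ̄_{sℓ} = 0 ↔ loc_λ κ̄_s = 0`) and its `hκ0` clause
(`κ̄_s ≠ 0 ↔ p^{M+1} ∤ P(D s)`). Construction: `κ̄_s :=` the level-`p` avatar (`exists_levelOne_avatar`, McCallum's class of
`P_s ∕ p^M`) on the standing inputs — admissibility of `E(K[s]) ⊆ E(K̄)` for `p^{M+1}` from irreducibility (x11b3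
`NoTorsionIrr`, PROVED Weil pairing, `p` unramified in `K`) and `[P_s]` invariant (Gross 3.6, this seat's
`Prop44.toGeomPoints_derivedPoint_mem_invPoints`); `h44c` is `h44` transported along `ι_*` (`localization_eq_zero_iff_transport`;
`Γ_{K_λ}` fixes `E[p^{M+1}]` at a Zhang–Kolyvagin prime of index `≥ M+1`, `Walk.resGal_adicCompletion_smul_torsion_eq_self`).
[cite: McCallumLMS1991, §4 Lemma 4.1, Prop. 4.4, Cor. 4.5] [cite: BurungaleEtAl2026, Prop. 2.2.1 (§2.2)]
[cite: GrossLMS1991, Prop. 3.6, §4 (4.1)] -/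
theorem exists_levelOne_kappa_of_h44 (hK : IsImaginaryQuadratic K) (hD : NumberField.discr K < -4)
    (hH : SatisfiesHeegnerHypothesis (W.conductorNorm ℤ) K) {p : ℕ} [Fact p.Prime] (hp2 : p ≠ 2)
    (hHp : SatisfiesHeegnerHypothesis p K) (hirr : W.HasIrreducibleModPGaloisRep p)
    (Dt : ModularParametrizationData W (W.conductorNorm ℤ)) (β : ℤ) (ι : K →+* ℂ) (M : ℕ)
    (D : ∀ s : {m : ℕ // Squarefree m ∧ ∀ q ∈ m.primeFactors,
        Zhang2014.IsKolyvaginPrime (W.conductorNorm ℤ) W K p q ∧ M + 1 ≤ Zhang2014.kolyvaginIndex W p q},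
      KolyvaginHeegnerData Dt β ι s.1)
    (hall : ∀ s, PDiv (D s) p M)
    (h44 : ∀ (s s' : {m : ℕ // Squarefree m ∧ ∀ q ∈ m.primeFactors,
        Zhang2014.IsKolyvaginPrime (W.conductorNorm ℤ) W K p q ∧ M + 1 ≤ Zhang2014.kolyvaginIndex W p q}) (ℓ : ℕ),
      Zhang2014.IsKolyvaginPrime (W.conductorNorm ℤ) W K p ℓ → M + 1 ≤ Zhang2014.kolyvaginIndex W p ℓ →
      ¬ ℓ ∣ s.1 → s'.1 = s.1 * ℓ → ∀ v : HeightOneSpectrum (𝓞 K), (ℓ : 𝓞 K) ∈ v.asIdeal →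
      ((D s').kolyvaginClass (Fact.out : p.Prime) (M + 1) ∈
          (W.baseChange K).torsionLocalKer (v.adicCompletion K) ((p ^ (M + 1) : ℕ) : ℤ) ↔
        (D s).kolyvaginClass (Fact.out : p.Prime) (M + 1) ∈
          (W.baseChange K).torsionLocalKer (v.adicCompletion K) ((p ^ (M + 1) : ℕ) : ℤ))) :
    ∃ κb : {m : ℕ // Squarefree m ∧ ∀ q ∈ m.primeFactors,
        Zhang2014.IsKolyvaginPrime (W.conductorNorm ℤ) W K p q ∧ M + 1 ≤ Zhang2014.kolyvaginIndex W p q} →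
        galoisCohomology ((W.baseChange K).torsionGaloisModule ((p ^ 1 : ℕ) : ℤ)) 1,
      (∀ s, torsionH1OfDvd (W.baseChange K)
          (Int.natCast_dvd_natCast.mpr (pow_dvd_pow p (Nat.le_add_left 1 M))) (κb s) =
        (D s).kolyvaginClass (Fact.out : p.Prime) (M + 1)) ∧
      (∀ (s s' : {m : ℕ // Squarefree m ∧ ∀ q ∈ m.primeFactors,
          Zhang2014.IsKolyvaginPrime (W.conductorNorm ℤ) W K p q ∧ M + 1 ≤ Zhang2014.kolyvaginIndex W p q}) (ℓ : ℕ),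
        Zhang2014.IsKolyvaginPrime (W.conductorNorm ℤ) W K p ℓ → M + 1 ≤ Zhang2014.kolyvaginIndex W p ℓ →
        ¬ ℓ ∣ s.1 → s'.1 = s.1 * ℓ → ∀ v : HeightOneSpectrum (𝓞 K), (ℓ : 𝓞 K) ∈ v.asIdeal →
        (galoisCohomology.localization ((W.baseChange K).torsionGaloisModule ((p ^ 1 : ℕ) : ℤ)) (Sum.inr v) 1
            (κb s') = 0 ↔
          galoisCohomology.localization ((W.baseChange K).torsionGaloisModule ((p ^ 1 : ℕ) : ℤ)) (Sum.inr v) 1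
            (κb s) = 0)) ∧
      (∀ s, κb s ≠ 0 ↔ ¬ PDiv (D s) p (M + 1)) := by
  have hp : p.Prime := Fact.out
  have hKunr : ∀ v : HeightOneSpectrum (𝓞 ℚ), (p : 𝓞 ℚ) ∈ v.asIdeal →
      Algebra.IsUnramifiedIn (𝓞 K) v.asIdeal :=
    isUnramifiedIn_of_satisfiesHeegnerHypothesis_of_dvd hK hHp hp (dvd_refl p)
  -- standing inputs at every member of the family
  have hA : ∀ s : {m : ℕ // Squarefree m ∧ ∀ q ∈ m.primeFactors,
      Zhang2014.IsKolyvaginPrime (W.conductorNorm ℤ) W K p q ∧ M + 1 ≤ Zhang2014.kolyvaginIndex W p q},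
      IsAdmissible (absoluteGaloisGroup K) (D s).pointsSubgroup ((p ^ (M + 1) : ℕ) : ℤ) := by
    intro s
    have hn0 : s.1 ≠ 0 := s.2.1.ne_zero
    have hpn : ¬ p ∣ s.1 := fun h ↦ (s.2.2 p (Nat.mem_primeFactors.mpr ⟨hp, h, hn0⟩)).1.2.2.2.1 rfl
    exact NoTorsionIrr.isAdmissible_pointsSubgroup_of_hasIrreducibleModPGaloisRep (D s) hK hn0 hp hp2 hirr
      (W.exists_weilPairing_holds p) hKunr hpn (M + 1)
  have hP : ∀ s : {m : ℕ // Squarefree m ∧ ∀ q ∈ m.primeFactors,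
      Zhang2014.IsKolyvaginPrime (W.conductorNorm ℤ) W K p q ∧ M + 1 ≤ Zhang2014.kolyvaginIndex W p q},
      (D s).toGeomPoints (D s).derivedPoint ∈
        invPoints (absoluteGaloisGroup K) (D s).pointsSubgroup ((p ^ (M + 1) : ℕ) : ℤ) :=
    fun s ↦ Prop44.toGeomPoints_derivedPoint_mem_invPoints hK ι hD hH Dt hp s.2.1 s.2.2 (D s)
  choose κb hκb using fun s ↦ exists_levelOne_avatar (D s) hp M (hA s) (hP s) (hall s)
  refine ⟨κb, fun s ↦ (hκb s).1, ?_, fun s ↦ not_congr (hκb s).2⟩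
  intro s s' ℓ hKol hidx hℓs hs' v hv
  have hdn : p ^ 1 ∣ p ^ (M + 1) := pow_dvd_pow p (Nat.le_add_left 1 M)
  have htriv : ∀ (g : absoluteGaloisGroup (v.adicCompletion K))
      (Q : geomTorsion (W.baseChange K) ((p ^ (M + 1) : ℕ) : ℤ)), resGal (K := K) (v.adicCompletion K) g • Q = Q :=
    Walk.resGal_adicCompletion_smul_torsion_eq_self W hK hKol hidx v hv
  refine localization_eq_zero_iff_transport W hdn (pow_ne_zero 1 hp.ne_zero) (pow_ne_zero _ hp.ne_zero) v htriv
    (κb s') (κb s) ?_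
  rw [(hκb s').1, (hκb s).1]
  haveI : CharZero (v.adicCompletion K) := charZero_of_injective_algebraMap (algebraMap K _).injective
  have hloc : ∀ z : galH1Torsion (W.baseChange K) ((p ^ (M + 1) : ℕ) : ℤ),
      galoisCohomology.localization ((W.baseChange K).torsionGaloisModule ((p ^ (M + 1) : ℕ) : ℤ)) (Sum.inr v) 1
          z = 0 ↔
        z ∈ (W.baseChange K).torsionLocalKer (v.adicCompletion K) ((p ^ (M + 1) : ℕ) : ℤ) := by
    intro z
    rw [mem_torsionLocalKer_iff_res_eq_zero (W := W.baseChange K) (E := v.adicCompletion K)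
      (pow_ne_zero (M + 1) hp.ne_zero)]
    exact Iff.rfl
  rw [hloc, hloc]
  exact h44 s s' ℓ hKol hidx hℓs hs' v hv


/-- **The level-`p^{M+1}` Prop-4.4 supplier for a family, BY NAME of Gross Prop. 3.7 (2), `p ∉ {2, 3}`.** For a
family `D` over Zhang–Kolyvagin conductors of index `≥ M+1` (`E[p]` irreducible, `K` Heegner for `N_E` with `d_K < −4`,
`p` split in `K`), the `h44` clause of `exists_levelOne_kappa_of_h44` — `c_{M+1}(D(sℓ))_λ = 0 ↔ c_{M+1}(D s)_λ = 0` at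
every Zhang–Kolyvagin prime step — from the named fact `GrossLMS1991.prop37_2_frobeniusCongruence` through this seat's
ANY-PAIR Prop. 4.4 (`Prop44.kolyvaginClass_mul_mem_torsionLocalKer_iff_of_irr`); Nekovář's clause `ℓ ≠ 2` holds because
`p^{M+1} ∣ ℓ + 1` with `p ≠ 3`. CONDITIONAL on the fact. [cite: McCallumLMS1991, §4 Prop. 4.4 (p. 301)]
[cite: GrossLMS1991, Prop. 3.7 (2) (p. 240)] [cite: Nekovar2007, Prop. 4.13 (ii)] -/
theorem h44_family_of_frobeniusCongruence (h37 : GrossLMS1991.prop37_2_frobeniusCongruence)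
    (hK : IsImaginaryQuadratic K) (hD : NumberField.discr K < -4)
    (hH : SatisfiesHeegnerHypothesis (W.conductorNorm ℤ) K) {p : ℕ} [Fact p.Prime] (hp2 : p ≠ 2) (hp3 : p ≠ 3)
    (hHp : SatisfiesHeegnerHypothesis p K) (hirr : W.HasIrreducibleModPGaloisRep p)
    (Dt : ModularParametrizationData W (W.conductorNorm ℤ)) (β : ℤ) (ι : K →+* ℂ) (M : ℕ)
    (D : ∀ s : {m : ℕ // Squarefree m ∧ ∀ q ∈ m.primeFactors,
        Zhang2014.IsKolyvaginPrime (W.conductorNorm ℤ) W K p q ∧ M + 1 ≤ Zhang2014.kolyvaginIndex W p q},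
      KolyvaginHeegnerData Dt β ι s.1) :
    ∀ (s s' : {m : ℕ // Squarefree m ∧ ∀ q ∈ m.primeFactors,
        Zhang2014.IsKolyvaginPrime (W.conductorNorm ℤ) W K p q ∧ M + 1 ≤ Zhang2014.kolyvaginIndex W p q}) (ℓ : ℕ),
      Zhang2014.IsKolyvaginPrime (W.conductorNorm ℤ) W K p ℓ → M + 1 ≤ Zhang2014.kolyvaginIndex W p ℓ →
      ¬ ℓ ∣ s.1 → s'.1 = s.1 * ℓ → ∀ v : HeightOneSpectrum (𝓞 K), (ℓ : 𝓞 K) ∈ v.asIdeal →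
      ((D s').kolyvaginClass (Fact.out : p.Prime) (M + 1) ∈
          (W.baseChange K).torsionLocalKer (v.adicCompletion K) ((p ^ (M + 1) : ℕ) : ℤ) ↔
        (D s).kolyvaginClass (Fact.out : p.Prime) (M + 1) ∈
          (W.baseChange K).torsionLocalKer (v.adicCompletion K) ((p ^ (M + 1) : ℕ) : ℤ)) := by
  have hp : p.Prime := Fact.out
  have hD3 : NumberField.discr K ≠ -3 := by omega
  have hD4 : NumberField.discr K ≠ -4 := by omega
  intro s s' ℓ hKol hidx hℓs hs' v hv
  obtain ⟨m', hm'⟩ := s'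
  change m' = s.1 * ℓ at hs'
  subst hs'
  have hn0 : s.1 * ℓ ≠ 0 := hm'.1.ne_zero
  have hcop : Nat.Coprime (s.1 * ℓ) (W.conductorNorm ℤ) :=
    (KolyvaginH37Bridge.coprime_of_forall_not_dvd hn0 fun q hq ↦ (hm'.2 q hq).1.2.1).symm
  have hℓ2 : ℓ ≠ 2 := by
    rintro rfl
    exact hp3 ((Nat.prime_dvd_prime_iff_eq hp Nat.prime_three).mp hKol.dvd.1)
  exact Prop44.kolyvaginClass_mul_mem_torsionLocalKer_iff_of_irr hK hD3 hD4 hH hp2 hHp hirr Dt β ι (M + 1)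
    (Nat.le_add_left 1 M) s.1 ℓ hm'.1 hKol.1 hℓs hm'.2 (D s) (D ⟨s.1 * ℓ, hm'⟩)
    (fun d₁ d₀ _ hΔ φ₀ hφ₀ hle γ _ ↦ h37.reductionCongruence_pair (N := W.conductorNorm ℤ) rfl hK ⟨hD3, hD4⟩ hH
      s.1 ℓ hm'.1 hcop (Or.inl hℓ2) hKol.2.2.2.2.1 d₁ d₀ hΔ hφ₀ hle γ) v hv

/-- **The same supplier AT `p = 3`, modulo the un-printed residue `ℓ = 2`.** At `p = 3` a Zhang–Kolyvagin prime `ℓ = 2`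
(index `1`: `2 ∤ N_E`, `2` inert in `K`, `3 ∣ a_2`) is possible when `M = 0`, and neither Nekovář (Prop. 4.13 (ii):
`ℓ𝒪_K ∤ (2)`) nor Gross (§2: surjective `p`) prints the congruence there; the `ℓ = 2` step is carried as the explicit
hypothesis `h2`, every other step comes from the named fact. CONDITIONAL on the fact.
[cite: McCallumLMS1991, §4 Prop. 4.4 (p. 301)] [cite: GrossLMS1991, Prop. 3.7 (2) (p. 240)] [cite: Nekovar2007, Prop. 4.13 (ii), (4.3)] -/
theorem h44_family_three_of_frobeniusCongruence (h37 : GrossLMS1991.prop37_2_frobeniusCongruence)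
    (hK : IsImaginaryQuadratic K) (hD : NumberField.discr K < -4)
    (hH : SatisfiesHeegnerHypothesis (W.conductorNorm ℤ) K)
    (hHp : SatisfiesHeegnerHypothesis 3 K) (hirr : W.HasIrreducibleModPGaloisRep 3)
    (Dt : ModularParametrizationData W (W.conductorNorm ℤ)) (β : ℤ) (ι : K →+* ℂ) (M : ℕ)
    (D : ∀ s : {m : ℕ // Squarefree m ∧ ∀ q ∈ m.primeFactors,
        Zhang2014.IsKolyvaginPrime (W.conductorNorm ℤ) W K 3 q ∧ M + 1 ≤ Zhang2014.kolyvaginIndex W 3 q},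
      KolyvaginHeegnerData Dt β ι s.1)
    (h2 : ∀ (s s' : {m : ℕ // Squarefree m ∧ ∀ q ∈ m.primeFactors,
        Zhang2014.IsKolyvaginPrime (W.conductorNorm ℤ) W K 3 q ∧ M + 1 ≤ Zhang2014.kolyvaginIndex W 3 q}),
      Zhang2014.IsKolyvaginPrime (W.conductorNorm ℤ) W K 3 2 → M + 1 ≤ Zhang2014.kolyvaginIndex W 3 2 →
      ¬ 2 ∣ s.1 → s'.1 = s.1 * 2 → ∀ v : HeightOneSpectrum (𝓞 K), (2 : 𝓞 K) ∈ v.asIdeal →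
      ((D s').kolyvaginClass Nat.prime_three (M + 1) ∈
          (W.baseChange K).torsionLocalKer (v.adicCompletion K) ((3 ^ (M + 1) : ℕ) : ℤ) ↔
        (D s).kolyvaginClass Nat.prime_three (M + 1) ∈
          (W.baseChange K).torsionLocalKer (v.adicCompletion K) ((3 ^ (M + 1) : ℕ) : ℤ))) :
    ∀ (s s' : {m : ℕ // Squarefree m ∧ ∀ q ∈ m.primeFactors,
        Zhang2014.IsKolyvaginPrime (W.conductorNorm ℤ) W K 3 q ∧ M + 1 ≤ Zhang2014.kolyvaginIndex W 3 q}) (ℓ : ℕ),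
      Zhang2014.IsKolyvaginPrime (W.conductorNorm ℤ) W K 3 ℓ → M + 1 ≤ Zhang2014.kolyvaginIndex W 3 ℓ →
      ¬ ℓ ∣ s.1 → s'.1 = s.1 * ℓ → ∀ v : HeightOneSpectrum (𝓞 K), (ℓ : 𝓞 K) ∈ v.asIdeal →
      ((D s').kolyvaginClass Nat.prime_three (M + 1) ∈
          (W.baseChange K).torsionLocalKer (v.adicCompletion K) ((3 ^ (M + 1) : ℕ) : ℤ) ↔
        (D s).kolyvaginClass Nat.prime_three (M + 1) ∈
          (W.baseChange K).torsionLocalKer (v.adicCompletion K) ((3 ^ (M + 1) : ℕ) : ℤ)) := by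
  haveI : Fact (Nat.Prime 3) := ⟨Nat.prime_three⟩
  have hD3 : NumberField.discr K ≠ -3 := by omega
  have hD4 : NumberField.discr K ≠ -4 := by omega
  intro s s' ℓ hKol hidx hℓs hs' v hv
  by_cases hℓ2 : ℓ = 2
  · subst hℓ2
    exact h2 s s' hKol hidx hℓs hs' v (by exact_mod_cast hv)
  obtain ⟨m', hm'⟩ := s'
  change m' = s.1 * ℓ at hs'
  subst hs'
  have hn0 : s.1 * ℓ ≠ 0 := hm'.1.ne_zero
  have hcop : Nat.Coprime (s.1 * ℓ) (W.conductorNorm ℤ) :=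
    (KolyvaginH37Bridge.coprime_of_forall_not_dvd hn0 fun q hq ↦ (hm'.2 q hq).1.2.1).symm
  exact Prop44.kolyvaginClass_mul_mem_torsionLocalKer_iff_of_irr hK hD3 hD4 hH (by decide) hHp hirr Dt β ι (M + 1)
    (Nat.le_add_left 1 M) s.1 ℓ hm'.1 hKol.1 hℓs hm'.2 (D s) (D ⟨s.1 * ℓ, hm'⟩)
    (fun d₁ d₀ _ hΔ φ₀ hφ₀ hle γ _ ↦ h37.reductionCongruence_pair (N := W.conductorNorm ℤ) rfl hK ⟨hD3, hD4⟩ hH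
      s.1 ℓ hm'.1 hcop (Or.inl hℓ2) hKol.2.2.2.2.1 d₁ d₀ hΔ hφ₀ hle γ) v hv

end Summit.BirchSwinnertonDyer.Rank1Residual.X11b.Three.Koly

end
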